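import Literature.Probability.FitznerVanDerHofstad2017.XSpaceCondition
import HarnessLib

/-!
# Fitzner–van der Hofstad 2017, §7 (7.1)–(7.2): the POINTWISE (supremum-free) reading — REFEREE-2 R13

CITATION HEADER (PLACEMENT v2). Part of the certified REPRODUCTION of R. Fitzner, R. van der Hofstad, *Mean-field
behavior for nearest-neighbor percolation in `d > 10`*, Electron. J. Probab. **22** (2017) no. 43 [FvdH17]; build
`lace`, seat lean1 (gen 6). ADDITIVE companion of `XSpaceCondition.lean` (nothing there is changed); like that file it
is OFF the packet's ladder (IRB ⇒ triangle ⇒ exponents) and nothing on the ladder imports it.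

WHY (REFEREE-2 R13, advisory). `XSpaceCondition.lean` types the two printed quantities of (7.1) as real suprema,
`criticalTbar00 d = ⨆_x (τ_{p_c}^{⋆3}(x) − δ_{0,x})` and `criticalTpc d = 2d·p_c·⨆_x (τ_{p_c}^{⋆3} ⋆ D)(x)`, and the
condition (7.2) as `HaraSharpenedCondition d : criticalTpc d · (1 + 2·criticalTbar00 d) < 1`.  A real `iSup` of a
family that is not bounded above takes the junk value `0` (`Real.iSup_of_not_bddAbove`), so the hypotheses
`criticalTbar00 11 ≤ 0.53562`, `criticalTpc 11 ≤ 0.28036` and the conclusion `HaraSharpenedCondition 11` would hold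
BY CONVENTION if those families were unbounded.  The referee asked that finiteness binders be supplied before any theorem
consumes (7.2) as a hypothesis (none does today).

WHAT THIS MODULE DOES.  It names the two families (`tbar00Family`, `tpcFamily`), states (7.1) POINTWISE —
`∀ x, τ^{⋆3}(x) − δ_{0,x} ≤ T̄` and `∀ x, 2d·p_c·(τ^{⋆3} ⋆ D)(x) ≤ T` — which is what a bound "`sup_x F(x) ≤ c`" means in
print and carries no supremum convention, and proves:
* the pointwise bounds IMPLY the `iSup` bounds with no side condition (`criticalTbar00_le_of_pointwise`,
  `criticalTpc_le_of_pointwise`; a pointwise bound is itself a `BddAbove` witness), hence imply (7.2)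
  (`haraSharpenedCondition_of_pointwise`) and give the `d = 11` dependency statement of `XSpaceCondition.lean` from
  pointwise (7.1) (`etaZeroXSpace_d11_of_openHypothesis_pointwise`);
* conversely the `iSup` bounds give the pointwise ones exactly under `BddAbove` (`le_criticalTbar00`, `le_criticalTpc`),
  so that the supremum-free condition `HaraSharpenedConditionPW d` (∃ pointwise bounds `T̄, T` with `T(1 + 2T̄) < 1`) is
  EQUIVALENT to `HaraSharpenedCondition d` on bounded families (`haraSharpenedConditionPW_iff`) and strictly stronger in
  general — a consumer of (7.2) should take `HaraSharpenedConditionPW d` (or the two pointwise bounds) as its hypothesis.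
NOT addressed here (recorded, not hidden): the lattice convolutions inside `τ^{⋆3} = convPow τ 3` and `τ^{⋆3} ⋆ D` are real
`tsum`s (`SpreadOutIsing.latticeConv`), themselves `0` by convention where not summable; the pointwise statements below
are statements about the tree's `convPow`, the same object any consumer (the binder `hH` of `XSpaceCondition.lean`) is
stated over, so no mismatch can arise inside the tree — whether they coincide with the printed sums is the summability of
`y ↦ τ^{⋆k}(y) τ(x − y)` (`k = 1, 2`), a consequence of the finiteness of the bubble/triangle at `p_c` that this module
neither assumes nor proves.

## References

* [FvdH17] R. Fitzner, R. van der Hofstad, Electron. J. Probab. 22 (2017) no. 43: §7 (7.1)–(7.2), pp. 61–62.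
-/

noncomputable section

namespace Literature.Probability.FitznerVanDerHofstad2017

open Literature.Probability.LatticeModels Literature.Probability.Percolation
  Literature.Barriers.CriticalPhenomena
open SpreadOutIsing (delta0 latticeConv convPow)

/-- The family under the supremum of `T̄^{(0,0)}`: `x ↦ τ_{p_c}^{⋆3}(x) − δ_{0,x}`.
[cite: FitznerVanDerHofstad2017, §7 (7.1), EJP p. 61] -/
def tbar00Family (d : ℕ) (x : Site d) : ℝ :=
  convPow (tau d (criticalProbI d) 0) 3 x - if x = 0 then (1 : ℝ) else 0

/-- The family under the supremum of `T_{p_c}` (before the factor `2d p_c`): `x ↦ (τ_{p_c}^{⋆3} ⋆ D)(x)`.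
[cite: FitznerVanDerHofstad2017, §7 (7.1), EJP p. 61] -/
def tpcFamily (d : ℕ) (x : Site d) : ℝ :=
  latticeConv (convPow (tau d (criticalProbI d) 0) 3) (srwStep d) x

/-- `T̄^{(0,0)} = ⨆_x tbar00Family x` (definitional). [folklore] -/
theorem criticalTbar00_eq (d : ℕ) : criticalTbar00 d = ⨆ x, tbar00Family d x := rfl

/-- `T_{p_c} = 2d·p_c·⨆_x tpcFamily x` (definitional). [folklore] -/
theorem criticalTpc_eq (d : ℕ) :
    criticalTpc d = 2 * d * (criticalProbI d : ℝ) * ⨆ x, tpcFamily d x := rfl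

/-- `(τ^{⋆3} ⋆ D)(x) ≥ 0`. [folklore] -/
theorem tpcFamily_nonneg (d : ℕ) (x : Site d) : 0 ≤ tpcFamily d x :=
  latticeConv_nonneg (convPow_nonneg_of_nonneg (fun _ => tau_nonneg _ _ _) 3)
    (fun y => srwStep_nonneg y) x

/-- `2d·p_c ≥ 0`. [folklore] -/
theorem two_d_pc_nonneg (d : ℕ) : 0 ≤ 2 * (d : ℝ) * (criticalProbI d : ℝ) :=
  mul_nonneg (mul_nonneg zero_le_two (Nat.cast_nonneg d)) (unitInterval.nonneg (criticalProbI d))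

/-- **(7.1), POINTWISE form**: `τ_{p_c}^{⋆3}(x) − δ_{0,x} ≤ T̄` and `2d·p_c·(τ_{p_c}^{⋆3} ⋆ D)(x) ≤ T` for every `x ∈ ℤ^d`
— the supremum-free content of "`T̄^{(0,0)} ≤ T̄`, `T_{p_c} ≤ T`".
[cite: FitznerVanDerHofstad2017, §7 (7.1), EJP p. 61] -/
def Eq71Pointwise (d : ℕ) (Tbar T : ℝ) : Prop :=
  (∀ x : Site d, tbar00Family d x ≤ Tbar) ∧
    ∀ x : Site d, 2 * d * (criticalProbI d : ℝ) * tpcFamily d x ≤ T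

/-- **(7.2), POINTWISE (supremum-free) form**: there are pointwise bounds `T̄, T` as in (7.1) with `T(1 + 2T̄) < 1`.
[cite: FitznerVanDerHofstad2017, §7 (7.2), EJP pp. 61–62] -/
def HaraSharpenedConditionPW (d : ℕ) : Prop :=
  ∃ Tbar T : ℝ, Eq71Pointwise d Tbar T ∧ T * (1 + 2 * Tbar) < 1

/-! ## Pointwise bounds imply the `iSup` bounds (no side condition) -/

/-- A pointwise bound on `τ^{⋆3} − δ` bounds `T̄^{(0,0)}` (the index type `ℤ^d` is non-empty; no `BddAbove`
hypothesis is needed — the pointwise bound is one). [folklore] -/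
theorem criticalTbar00_le_of_pointwise {d : ℕ} {Tbar : ℝ} (h : ∀ x : Site d, tbar00Family d x ≤ Tbar) :
    criticalTbar00 d ≤ Tbar :=
  ciSup_le h

/-- A pointwise bound on `2d·p_c·(τ^{⋆3} ⋆ D)` bounds `T_{p_c}`. [folklore] -/
theorem criticalTpc_le_of_pointwise {d : ℕ} {T : ℝ}
    (h : ∀ x : Site d, 2 * d * (criticalProbI d : ℝ) * tpcFamily d x ≤ T) : criticalTpc d ≤ T := by
  rw [criticalTpc_eq, Real.mul_iSup_of_nonneg (two_d_pc_nonneg d)]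
  exact ciSup_le h

/-- A pointwise bound is a `BddAbove` witness for the `T̄^{(0,0)}` family. [folklore] -/
theorem bddAbove_tbar00Family_of_pointwise {d : ℕ} {Tbar : ℝ} (h : ∀ x : Site d, tbar00Family d x ≤ Tbar) :
    BddAbove (Set.range (tbar00Family d)) :=
  ⟨Tbar, by rintro _ ⟨x, rfl⟩; exact h x⟩

/-- A pointwise bound on `2d·p_c·(τ^{⋆3} ⋆ D)` is a `BddAbove` witness for the `T_{p_c}` family as soon as
`2d·p_c ≠ 0`. [folklore] -/
theorem bddAbove_tpcFamily_of_pointwise {d : ℕ} {T : ℝ} (hc : 2 * (d : ℝ) * (criticalProbI d : ℝ) ≠ 0)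
    (h : ∀ x : Site d, 2 * d * (criticalProbI d : ℝ) * tpcFamily d x ≤ T) :
    BddAbove (Set.range (tpcFamily d)) := by
  have hc' : 0 < 2 * (d : ℝ) * (criticalProbI d : ℝ) := lt_of_le_of_ne (two_d_pc_nonneg d) (Ne.symm hc)
  refine ⟨T / (2 * d * (criticalProbI d : ℝ)), ?_⟩
  rintro _ ⟨x, rfl⟩
  rw [le_div_iff₀ hc', mul_comm]
  exact h x

/-- **Pointwise (7.1) with `T(1 + 2T̄) < 1` implies (7.2)** as typed in `XSpaceCondition.lean`. [folklore] -/
theorem haraSharpenedCondition_of_pointwise {d : ℕ} {Tbar T : ℝ} (h71 : Eq71Pointwise d Tbar T)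
    (h72 : T * (1 + 2 * Tbar) < 1) : HaraSharpenedCondition d := by
  have h0 : 0 ≤ criticalTpc d := criticalTpc_nonneg d
  have h1 : criticalTbar00 d ≤ Tbar := criticalTbar00_le_of_pointwise h71.1
  have h2 : criticalTpc d ≤ T := criticalTpc_le_of_pointwise h71.2
  unfold HaraSharpenedCondition
  have h3 : criticalTpc d * (1 + 2 * criticalTbar00 d) ≤ criticalTpc d * (1 + 2 * Tbar) :=
    mul_le_mul_of_nonneg_left (by linarith) h0
  rcases le_or_gt (1 + 2 * Tbar) 0 with hneg | hpos
  · exact lt_of_le_of_lt (h3.trans (mul_nonpos_of_nonneg_of_nonpos h0 hneg)) one_pos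
  · exact lt_of_le_of_lt (h3.trans (mul_le_mul_of_nonneg_right h2 hpos.le)) h72

/-- `HaraSharpenedConditionPW d → HaraSharpenedCondition d`. [folklore] -/
theorem haraSharpenedCondition_of_pw {d : ℕ} (h : HaraSharpenedConditionPW d) : HaraSharpenedCondition d := by
  obtain ⟨Tbar, T, h71, h72⟩ := h
  exact haraSharpenedCondition_of_pointwise h71 h72

/-! ## The converse direction needs exactly `BddAbove` -/

/-- On a bounded family the supremum dominates each term: `τ^{⋆3}(x) − δ_{0,x} ≤ T̄^{(0,0)}`. [folklore] -/
theorem le_criticalTbar00 {d : ℕ} (hB : BddAbove (Set.range (tbar00Family d))) (x : Site d) :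
    tbar00Family d x ≤ criticalTbar00 d :=
  le_ciSup hB x

/-- On a bounded family, `2d·p_c·(τ^{⋆3} ⋆ D)(x) ≤ T_{p_c}`. [folklore] -/
theorem le_criticalTpc {d : ℕ} (hB : BddAbove (Set.range (tpcFamily d))) (x : Site d) :
    2 * d * (criticalProbI d : ℝ) * tpcFamily d x ≤ criticalTpc d :=
  mul_le_mul_of_nonneg_left (le_ciSup hB x) (two_d_pc_nonneg d)

/-- On bounded families, (7.2) as typed gives the pointwise form with `T̄ = T̄^{(0,0)}`, `T = T_{p_c}`. [folklore] -/
theorem haraSharpenedConditionPW_of_bddAbove {d : ℕ} (hB1 : BddAbove (Set.range (tbar00Family d)))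
    (hB2 : BddAbove (Set.range (tpcFamily d))) (h : HaraSharpenedCondition d) :
    HaraSharpenedConditionPW d :=
  ⟨criticalTbar00 d, criticalTpc d, ⟨le_criticalTbar00 hB1, le_criticalTpc hB2⟩, h⟩

/-- **Equivalence on bounded families**: the supremum-free (7.2) ↔ (7.2) as typed.  Without `BddAbove` only `→`
holds (an unbounded family makes the right-hand side true by the convention `⨆ = 0`). [folklore] -/
theorem haraSharpenedConditionPW_iff {d : ℕ} (hB1 : BddAbove (Set.range (tbar00Family d)))
    (hB2 : BddAbove (Set.range (tpcFamily d))) :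
    HaraSharpenedConditionPW d ↔ HaraSharpenedCondition d :=
  ⟨haraSharpenedCondition_of_pw, haraSharpenedConditionPW_of_bddAbove hB1 hB2⟩

/-! ## `d = 11` -/

/-- **§7 at `d = 11` from POINTWISE (7.1)**: `∀ x, τ^{⋆3}(x) − δ_{0,x} ≤ 0.53562` and
`∀ x, 22·p_c·(τ^{⋆3} ⋆ D)(x) ≤ 0.28036` (the printed numbers, a COMPUTATIONAL CLAIM of the paper, never cited as a
fact) imply (7.2): `0.28036·(1 + 2·0.53562) = 0.5806928… < 1`.
[cite: FitznerVanDerHofstad2017, §7, EJP p. 62 ("The bound in (7.2) follows from (7.1)")] -/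
theorem haraSharpenedCondition_d11_of_eq71_pointwise
    (hTb : ∀ x : Site 11, tbar00Family 11 x ≤ 0.53562)
    (hTp : ∀ x : Site 11, 2 * (11 : ℕ) * (criticalProbI 11 : ℝ) * tpcFamily 11 x ≤ 0.28036) :
    HaraSharpenedCondition 11 :=
  haraSharpenedCondition_of_pointwise ⟨hTb, hTp⟩ (by norm_num)

/-- The pointwise (7.1) at `d = 11` also gives the supremum-free (7.2). [folklore] -/
theorem haraSharpenedConditionPW_d11_of_eq71_pointwise
    (hTb : ∀ x : Site 11, tbar00Family 11 x ≤ 0.53562)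
    (hTp : ∀ x : Site 11, 2 * (11 : ℕ) * (criticalProbI 11 : ℝ) * tpcFamily 11 x ≤ 0.28036) :
    HaraSharpenedConditionPW 11 :=
  ⟨0.53562, 0.28036, ⟨hTb, hTp⟩, by norm_num⟩

/-- **The dependency statement of `XSpaceCondition.lean` with POINTWISE (7.1)** (documentation of the dependency,
not a result; the binder `hH` — "(7.2) suffices" — is the OPEN HYPOTHESIS of GAPS G3, exactly as in
`etaZeroXSpace_d11_of_openHypothesis`, and is deliberately not a named `def`).
[cite: FitznerVanDerHofstad2017, Thm. 1.4 (EJP p. 6) and §7 (7.1)–(7.2) (EJP pp. 61–62)] -/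
theorem etaZeroXSpace_d11_of_openHypothesis_pointwise
    (hH : TriangleCondition 11 → HaraSharpenedCondition 11 → EtaZeroXSpace 11)
    (hT : TriangleCondition 11) (hTb : ∀ x : Site 11, tbar00Family 11 x ≤ 0.53562)
    (hTp : ∀ x : Site 11, 2 * (11 : ℕ) * (criticalProbI 11 : ℝ) * tpcFamily 11 x ≤ 0.28036) :
    EtaZeroXSpace 11 :=
  hH hT (haraSharpenedCondition_d11_of_eq71_pointwise hTb hTp)

/-- The same dependency statement with the consumer hypothesis in its recommended, supremum-free form
`HaraSharpenedConditionPW 11` (REFEREE-2 R13). [cite: FitznerVanDerHofstad2017, Thm. 1.4 (EJP p. 6) and §7 (7.1)–(7.2) (EJP pp. 61–62)] -/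
theorem etaZeroXSpace_d11_of_openHypothesisPW
    (hH : TriangleCondition 11 → HaraSharpenedConditionPW 11 → EtaZeroXSpace 11)
    (hT : TriangleCondition 11) (hTb : ∀ x : Site 11, tbar00Family 11 x ≤ 0.53562)
    (hTp : ∀ x : Site 11, 2 * (11 : ℕ) * (criticalProbI 11 : ℝ) * tpcFamily 11 x ≤ 0.28036) :
    EtaZeroXSpace 11 :=
  hH hT (haraSharpenedConditionPW_d11_of_eq71_pointwise hTb hTp)

end Literature.Probability.FitznerVanDerHofstad2017

end
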